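import Summits.CriticalPhenomena.CardyFormulaZ2.Theses.CardyQContinuation
import Literature.Probability.LatticeModels.DomainDiscretisation
import Literature.Probability.RandomPlanarGeometry.PlanarDomains
import Literature.Probability.RandomPlanarGeometry.PlanarDomainsTopology

/-!
# Crux `IsingJetsConformal`, stub `stub_isingCrossingConformal_meshBoundary_eq_iUnion_discreteArc`:
# the discrete boundary of `Ω_δ` is the union of the four discrete arcs
# (route `CardyQContinuation`, item stmt-CriticalPhenomena-5560)

The tree discretises a conformal rectangle `R` (a Jordan domain with four marked boundary points,
closed boundary arcs `R.arc i`, `i : Fin 4`, whose union is `frontier R.carrier`,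
`MarkedDomain.iUnion_arc_holds`) by the discrete domain `Ω_δ = meshDomain R.carrier δ ⊆ ℤ²` with
vertex boundary `meshBoundary R.carrier δ` and discrete arcs
`discreteArc Ω δ A = {x ∈ meshBoundary Ω δ | infDist (δx) A ≤ infDist (δx) (∂Ω ∖ A)}`
(`DomainDiscretisation.lean`; Smirnov 2001, §2: "the discrete arc is the set of boundary vertices
closest to the arc"). The `n = 0` bridge of the crux needs that the four discrete arcs COVER the
discrete boundary. This file proves it, for every mesh `δ` (the argument is pointwise in the mesh
point): `meshBoundary R.carrier δ = ⋃ i, discreteArc R.carrier δ (R.arc i)`.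

Proof. `⊇` is `discreteArc_subset_meshBoundary`. `⊆`: for a discrete boundary vertex `x` with mesh
point `z`, the function `i ↦ infDist z (R.arc i)` on the finite type `Fin 4` attains its minimum at
some `j`; then every `w ∈ ∂Ω ∖ R.arc j` lies on some arc `R.arc k` (the arcs cover `∂Ω`), so
`infDist z (R.arc j) ≤ infDist z (R.arc k) ≤ dist z w`, whence
`infDist z (R.arc j) ≤ infDist z (∂Ω ∖ R.arc j)` (`Metric.le_infDist`, which needs
`∂Ω ∖ R.arc j ≠ ∅`: the midpoint of any other arc is a boundary point off `R.arc j`,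
`MarkedDomain.boundary_not_mem_arc`).

References: S. Smirnov, C. R. Acad. Sci. Paris 333 (2001), §2 (the discretisation);
D. Chelkak, S. Smirnov, Invent. Math. 189 (2012), §1.2.
-/

namespace Summit.CriticalPhenomena.CardyFormulaZ2.Theorems.CardyQContinuation

open Set Metric
open Literature.Probability.LatticeModels
open Literature.Probability.RandomPlanarGeometry

noncomputable section

namespace MeshBoundaryUnionArcs

/-- **The boundary minus one arc is nonempty** (marked domain with `n ≥ 1` marks and two distinct
indices `i ≠ j`): the boundary point at the midpoint parameter of arc `i` lies on the frontier but
not on arc `j` (injectivity of the boundary loop on a period, `boundary_not_mem_arc`). [folklore] -/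
theorem frontier_diff_arc_nonempty_of_ne {n : ℕ} [NeZero n] (D : MarkedDomain n) {i j : Fin n}
    (hij : j ≠ i) : (frontier D.carrier \ D.arc j).Nonempty :=
  ⟨D.boundary ((D.mark i + D.nextMark i) / 2), D.boundary_mem_frontier _,
    D.boundary_not_mem_arc hij (D.midpoint_mem_Ioo i)⟩

/-- **Closest-arc rule**: a discrete boundary vertex whose mesh point is at least as close to the
arc `R.arc j` as to every arc `R.arc i` belongs to the discrete arc of `R.arc j` — every point of
`∂Ω ∖ R.arc j` lies on some arc (the arcs cover the frontier, `iUnion_arc_holds`).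
(Smirnov 2001, §2.) [folklore] -/
theorem mem_discreteArc_arc_of_forall_infDist_le (R : ConformalRectangle) {δ : ℝ} {x : Site 2}
    (hx : x ∈ meshBoundary R.carrier δ) {j : Fin 4}
    (hj : ∀ i, infDist (meshPoint δ x) (R.arc j) ≤ infDist (meshPoint δ x) (R.arc i)) :
    x ∈ discreteArc R.carrier δ (R.arc j) := by
  refine ⟨hx, ?_⟩
  obtain ⟨i, hi⟩ := exists_ne j
  refine (le_infDist (frontier_diff_arc_nonempty_of_ne R (i := i) hi.symm)).2 fun w hw => ?_
  have hw' : w ∈ ⋃ k, R.arc k := by rw [R.iUnion_arc_holds]; exact hw.1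
  obtain ⟨k, hk⟩ := mem_iUnion.1 hw'
  exact (hj k).trans (infDist_le_dist_of_mem hk)

end MeshBoundaryUnionArcs

open MeshBoundaryUnionArcs

/-- **Stub `stub_isingCrossingConformal_meshBoundary_eq_iUnion_discreteArc`** of the skeleton of
the crux `IsingJetsConformal` (stmt-CriticalPhenomena-5560): the discrete boundary of the tree's
discretisation `Ω_δ` of a conformal rectangle is the union of the four discrete arcs — every
discrete boundary vertex is assigned to (at least) its nearest arc (`Finset.exists_min_image` on
`Fin 4` and the closest-arc rule `mem_discreteArc_arc_of_forall_infDist_le`), for every mesh `δ`.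
(Smirnov 2001, §2.) [folklore] -/
theorem stub_isingCrossingConformal_meshBoundary_eq_iUnion_discreteArc : (∀ (R : Literature.Probability.RandomPlanarGeometry.ConformalRectangle) (δ : ℝ), Literature.Probability.LatticeModels.meshBoundary R.carrier δ = ⋃ i : Fin 4, Literature.Probability.LatticeModels.discreteArc R.carrier δ (R.arc i)) := by
  intro R δ
  refine Subset.antisymm (fun x hx => ?_)
    (iUnion_subset fun i => discreteArc_subset_meshBoundary _ _ _)
  obtain ⟨j, -, hj⟩ := Finset.exists_min_image Finset.univ
    (fun i : Fin 4 => infDist (meshPoint δ x) (R.arc i)) Finset.univ_nonempty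
  exact mem_iUnion.2 ⟨j, mem_discreteArc_arc_of_forall_infDist_le R hx
    fun i => hj i (Finset.mem_univ i)⟩

end

end Summit.CriticalPhenomena.CardyFormulaZ2.Theorems.CardyQContinuation
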